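import Literature.Topology.FourManifolds.TautFoliationsDiscFoliation
import Literature.Topology.FourManifolds.TautFoliationsFoliatedMaps
import HarnessLib

/-!
# The filling map of a disc in checkerboard cone position is a foliated map

For a cone position `P` of a square in a `3`-manifold with a transversely oriented `C⁰`
codimension-one foliation `F` (`TautFoliationsConePosition.lean`) the square minus the centres
and vertices carries the bi-oriented contour foliation `P.contourFol ho`
(`TautFoliationsDiscFoliation.lean`), every chart of which reads, as height, the height of a
flow box of `F` at the image under the filling `P.fill P.apex` (`ConePosition.chart_height`),
renormalised onto the line. Consequently **the filling, restricted to the carrier, is a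
foliated map from the contour foliation to `F`** in the sense of
`TautFoliationsFoliatedMaps.lean` (`ConePosition.isFoliatedMap_fill`): the holonomy of a closed
orbit of the contour foliation is that of its image (naturality of holonomy), images of the
fences of the contour foliation are fences of `F`, and the band-openness theorem of
`Literature/Topology/PlanarFoliations/BandOpen.lean` applies to the disc (Camacho–Lins Neto,
*Geometric Theory of Foliations*, Ch. VI §3, Ch. VII §2).

* `ConePosition.continuous_fill_coe` (**proved**): the filling is continuous on the carrier.
* `ConePosition.snd_orientChart` (**proved**): orienting a chart keeps its height.
* `ConePosition.isFoliatedMap_fill` (**proved**): the theorem.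

## References

* C. Camacho, A. Lins Neto, *Geometric Theory of Foliations*, Birkhäuser (1985), Ch. VI §3,
  Ch. VII §2 [CamachoLinsNeto1985].
-/

noncomputable section

open Set Filter Metric Topology
open Literature.Topology.PlanarFoliations

namespace Literature.Topology.FourManifolds

open ConeSquare SquareGrid

namespace Foliation

variable {B : Type*} [NormedAddCommGroup B] [NormedSpace ℝ B] {M : Type*} [TopologicalSpace M]
  {F : Foliation B M} {f : ℝ × ℝ → M} {c₀ : ℝ × ℝ} {L : ℝ} {hL : 0 < L}

namespace ConePosition

variable (P : ConePosition F f c₀ hL)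

/-- **The filling is continuous on the carrier** (the carrier lies in the big ball, inside the
closed square on which the filling is continuous). [folklore] -/
theorem continuous_fill_coe : Continuous fun y : P.gr.X₀ ↦ P.fill P.apex (y : ℝ × ℝ) := by
  refine (P.continuousOn_fill (m := P.apex)).comp_continuous continuous_subtype_val fun y ↦ ?_
  have hy := ((P.gr.mem_X₀_iff).1 y.2).1
  rw [← grid_S hL P.hn]
  exact ball_subset_closedBall hy

/-- Orienting a planar chart does not change its height coordinate — DEPRECATED duplicate of
`Literature.Topology.PlanarFoliations.orientChart_snd` (`BiOrient.lean`, `ι` implicit there;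
librarian dedup 2026-08-16, work item dedup-01240); kept as a one-line alias proof. [folklore] -/
@[deprecated Literature.Topology.PlanarFoliations.orientChart_snd (since := "2026-08-16")]
theorem snd_orientChart {X : Type*} [TopologicalSpace X] (ι : X → ℂ) (e : OpenPartialHomeomorph X (ℝ × ℝ))
    (y : X) : (orientChart ι e y).2 = (e y).2 :=
  orientChart_snd e y

/-- Orienting a planar chart does not change its source — DEPRECATED duplicate of
`Literature.Topology.PlanarFoliations.orientChart_source` (`BiOrient.lean`, `ι` implicit there;
librarian dedup 2026-08-16); kept as a one-line alias proof. [folklore] -/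
@[deprecated Literature.Topology.PlanarFoliations.orientChart_source (since := "2026-08-16")]
theorem source_orientChart {X : Type*} [TopologicalSpace X] (ι : X → ℂ) (e : OpenPartialHomeomorph X (ℝ × ℝ)) :
    (orientChart ι e).source = e.source :=
  orientChart_source e

/-- An interval chart is a homeomorphism germ at every point of its interval. [folklore] -/
theorem isHomeoGermAt_intervalChart {a b : ℝ} (h : a < b) {s : ℝ} (hs : s ∈ Ioo a b) :
    IsHomeoGermAt (intervalChart a b h) s := by
  refine ⟨min (s - a) (b - s), lt_min (by linarith [hs.1]) (by linarith [hs.2]), ?_, Or.inl ?_⟩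
  · have hsub : Ioo (s - min (s - a) (b - s)) (s + min (s - a) (b - s)) ⊆ Ioo a b :=
      Ioo_subset_Ioo (by linarith [min_le_left (s - a) (b - s)]) (by linarith [min_le_right (s - a) (b - s)])
    have hc : ContinuousOn (intervalChart a b h) (Ioo a b) := by
      rw [← intervalChart_source a b h]
      exact (intervalChart a b h).continuousOn
    exact hc.mono hsub
  · exact (strictMonoOn_intervalChart a b h).mono
      (Ioo_subset_Ioo (by linarith [min_le_left (s - a) (b - s)]) (by linarith [min_le_right (s - a) (b - s)]))

/-- **The filling of a disc in checkerboard cone position is a foliated map** from the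
bi-oriented contour foliation of the carrier to `F`: near every point, the height of a chart of
the contour foliation is the renormalisation (an interval chart, a homeomorphism germ) of the
height of a flow box of `F` at the image (`chart_height`). [folklore] -/
theorem isFoliatedMap_fill (ho : F.IsTransverselyOriented) :
    IsFoliatedMap (P.contourFol ho) F fun y : P.gr.X₀ ↦ P.fill P.apex (y : ℝ × ℝ) := by
  refine ⟨P.continuous_fill_coe, fun x ↦ ?_⟩
  obtain ⟨d, hd, hxd⟩ := (P.contourFol ho).exists_mem_source x
  refine ⟨d, hd, hxd, ?_⟩
  -- unpack the chart: the oriented version of a renormalised restricted plane chart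
  obtain ⟨d₀, hd₀, rfl⟩ := hd
  obtain ⟨c, hc, p, r, hr, hbox, rfl⟩ := hd₀
  obtain ⟨ĉ, hĉ, rfl⟩ := hc
  obtain ⟨q₀, hq₀⟩ := P.chart_height ho hĉ
  haveI := P.gr.nonempty_X₀
  -- the point lies in the source of the plane chart, at a height inside the renormalised interval
  have hxsrc : x ∈ (renormBox (ĉ.subtypeRestr P.gr.nonempty_X₀) p r hr).source := by
    rwa [orientChart_source] at hxd
  obtain ⟨hxc, hxbox⟩ := mem_renormBox_source_iff.1 hxsrc
  have hxĉ : (x : ℝ × ℝ) ∈ ĉ.source := by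
    rw [OpenPartialHomeomorph.subtypeRestr_source] at hxc
    exact hxc
  obtain ⟨hfx, hhx⟩ := hq₀ _ hxĉ
  refine ⟨P.box q₀, P.box_mem q₀, hfx, intervalChart (p.2 - r) (p.2 + r) (by linarith), ?_, ?_⟩
  · -- the renormalisation is a homeomorphism germ at the height of the image
    have hs : (ĉ (x : ℝ × ℝ)).2 ∈ Ioo (p.2 - r) (p.2 + r) := by
      obtain ⟨-, h₂⟩ := hxbox
      exact h₂
    rw [hhx] at hs
    exact isHomeoGermAt_intervalChart _ hs
  · -- on the source of the chart, its height is the renormalised height of `P.box q₀ ∘ fill`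
    have hopen : IsOpen (orientChart P.gr.planeEmb (renormBox (ĉ.subtypeRestr P.gr.nonempty_X₀) p r hr)).source :=
      OpenPartialHomeomorph.open_source _
    filter_upwards [hopen.mem_nhds hxd] with y hy
    rw [orientChart_source] at hy
    obtain ⟨hyc, -⟩ := mem_renormBox_source_iff.1 hy
    have hyĉ : (y : ℝ × ℝ) ∈ ĉ.source := by
      rw [OpenPartialHomeomorph.subtypeRestr_source] at hyc
      exact hyc
    obtain ⟨-, hhy⟩ := hq₀ _ hyĉ
    simp only [Function.comp_apply, height_apply]
    rw [orientChart_snd, renormBox_apply]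
    show intervalChart (p.2 - r) (p.2 + r) _ (ĉ (y : ℝ × ℝ)).2 = _
    rw [hhy]
    rfl

end ConePosition

end Foliation

end Literature.Topology.FourManifolds
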